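/-
Copyright (c) 2026. All rights reserved.
Released under Apache 2.0 license as described in the file LICENSE.
-/
import Summits.Langlands.Langlands.Theorems.SoloInformedAmaxGaloisInvariants
import Summits.Langlands.Langlands.Theorems.SoloInformedRepairD2Cris
import HarnessLib

/-!
# `(B_max⁺)^{Γ_F} = K₀` inside `B_max(F) = A_max[1/t]`: the rational untwisted layer

Solo/informed seat, programme Λ, file Λ3 (a formal corollary of Λ2 `SpecC.forall_galBmaxPlus_iff`).  In the
constructed ring `D2Cris.Bmax F p = A_max[1/t]` of the D2-cris repair (`SoloInformedRepairD2Cris` §2; `p` is a unit there,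
`D2Cris.isUnit_natCast_bmax`), call `y` **`p`-integral up to `pⁿ`** if `y·pⁿ ∈ A_max` — these are exactly the elements of
`B_max⁺(F) = A_max[1/p] ⊆ B_max(F)`.  We prove:

* `algebraMap_bmax_injective` — `A_max → A_max[1/t]` is injective (`A_max` is a domain, `t ≠ 0`);
* `forall_galBmax_iff_forall_galBmaxPlus` — for `y·pⁿ = x ∈ A_max`: `y` is `Γ_F`-invariant iff `x` is;
* ★ `forall_galBmax_iff_of_isPIntegral` — **a `p`-integral-up-to-`pⁿ` element `y ∈ B_max(F)` is `Γ_F`-invariant iff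
  `y·pᵐ = ι z` for some `m` and some `Γ_F`-invariant `z ∈ W(k̄)`**, i.e. `(B_max⁺(F))^{Γ_F} = ι(W(k̄)^{Γ_F})[1/p] = K₀ = W(k_F)[1/p]`.

What remains of input (I2) `B_max(F)^{Γ_F} = F₀` after this file is exactly the twisted layers `(A_max)^{Γ_F = χᵏ}`, `k ≥ 1`
(elements `a/tᵏ`), which need the fundamental lemma `F ⊗_{F₀} B_max⁺ ↪ B_dR⁺` (not in the tree).

References: Colmez, Ann. of Math. 148 (1998), §III.2; Fontaine, Astérisque 223 (1994), Exp. III §4.1.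
-/

noncomputable section

open WittVector Field IsLocalRing ValuativeRel
open Literature.NumberTheory.GaloisRepresentations Literature.NumberTheory.PAdicHodge
open Literature.NumberTheory.GaloisRepresentations.IsNonarchimedeanLocalField

namespace Summit.Langlands.Langlands.Theorems

namespace SpecC

variable {F : Type} [Field F] [ValuativeRel F] [TopologicalSpace F] [IsNonarchimedeanLocalField F] [CharZero F]
  {p : ℕ} [Fact p.Prime] [Fact (¬ IsUnit (p : integerC F))] [IsAdicComplete (Ideal.span {(p : integerC F)}) (integerC F)]
  [CharP (ResidueField (integerC F)) p]

omit [CharP (ResidueField (integerC F)) p] in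
/-- **`t ≠ 0` in `A_max`** (its image in `B_dR⁺` is `t_dR ≠ 0`). [cite: FontaineAsterisque223III, Exp. II §1.5.4] -/
theorem tBmax_ne_zero (hp : valuation F p < 1) : (tBmax : BmaxPlus F p) ≠ 0 := fun h =>
  tBdR_ne_zero (surjective_fontaineTheta_integerC hp) (by rw [← bmaxPlusToBdR_tBmax (F := F) (p := p), h, map_zero])

omit [CharP (ResidueField (integerC F)) p] in
/-- **`A_max → B_max(F) = A_max[1/t]` is injective** (`A_max` has no zero divisors and `t ≠ 0`). [cite: Colmez1998Annals, §III.2] -/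
theorem algebraMap_bmax_injective (hp : valuation F p < 1) :
    Function.Injective (algebraMap (BmaxPlus F p) (D2Cris.Bmax F p)) :=
  haveI := noZeroDivisors_bmaxPlus (F := F) (p := p) hp
  IsLocalization.injective (M := Submonoid.powers (tBmax (F := F) (p := p))) (D2Cris.Bmax F p)
    (powers_le_nonZeroDivisors_of_noZeroDivisors (tBmax_ne_zero hp))

omit [CharP (ResidueField (integerC F)) p] in
/-- **For `y·pⁿ = x ∈ A_max`, `y ∈ B_max(F)` is `Γ_F`-invariant iff `x` is** (`p` is a `Γ_F`-invariant unit of `B_max(F)`,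
`A_max ↪ B_max(F)`). [folklore] -/
theorem forall_galBmax_iff_forall_galBmaxPlus (hp : valuation F p < 1) {y : D2Cris.Bmax F p} {n : ℕ} {x : BmaxPlus F p}
    (hy : y * (p : D2Cris.Bmax F p) ^ n = algebraMap (BmaxPlus F p) (D2Cris.Bmax F p) x) :
    (∀ σ : absoluteGaloisGroup F, D2Cris.galBmax σ y = y) ↔ ∀ σ : absoluteGaloisGroup F, galBmaxPlus σ x = x := by
  refine ⟨fun h σ => algebraMap_bmax_injective hp ?_, fun h σ => ?_⟩
  · rw [← D2Cris.galBmax_algebraMap, ← hy, map_mul, map_pow, map_natCast, h σ]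
  · have h1 := congrArg (D2Cris.galBmax (F := F) (p := p) σ) hy
    rw [map_mul, map_pow, map_natCast, D2Cris.galBmax_algebraMap, h σ, ← hy] at h1
    exact ((D2Cris.isUnit_natCast_bmax (F := F) (p := p)).pow n).mul_left_inj.1 h1

section Main

variable [Fact (¬ IsUnit (p : maxUnramifiedCompletion F))] [CharP (ResidueField (maxUnramifiedCompletion F)) p]

/-- ★ **`(B_max⁺(F))^{Γ_F} = K₀`**: an element `y` of `B_max(F) = A_max[1/t]` which is `p`-integral up to a power of `p`
(`y·pⁿ ∈ A_max`, i.e. `y ∈ B_max⁺ = A_max[1/p]`) is `Γ_F`-invariant iff `y·pᵐ = ι z` for some `m` and some `Γ_F`-invariant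
unramified Witt vector `z ∈ W(k̄)` (an element of `W(k_F)`), i.e. iff `y ∈ K₀ = W(k_F)[1/p]`. [cite: Colmez1998Annals, §III.2]
[cite: FontaineAsterisque223III, Exp. III §4.1] -/
theorem forall_galBmax_iff_of_isPIntegral (hp : valuation F p < 1) {y : D2Cris.Bmax F p}
    (hint : ∃ (n : ℕ) (x : BmaxPlus F p), y * (p : D2Cris.Bmax F p) ^ n = algebraMap (BmaxPlus F p) (D2Cris.Bmax F p) x) :
    (∀ σ : absoluteGaloisGroup F, D2Cris.galBmax σ y = y) ↔
      ∃ (n : ℕ) (z : WittVector p (ResidueField (maxUnramifiedCompletion F))),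
        (∀ σ : absoluteGaloisGroup F, WittVector.map (residueGal σ) z = z) ∧
          y * (p : D2Cris.Bmax F p) ^ n = algebraMap (BmaxPlus F p) (D2Cris.Bmax F p) (ainfToBmaxPlus F p (wittToAinf F p z)) := by
  constructor
  · intro hy
    obtain ⟨n, x, hx⟩ := hint
    obtain ⟨z, hz, rfl⟩ := exists_eq_wittToAinf_of_forall_galBmaxPlus hp ((forall_galBmax_iff_forall_galBmaxPlus hp hx).1 hy)
    exact ⟨n, z, hz, hx⟩
  · rintro ⟨n, z, hz, hx⟩
    exact (forall_galBmax_iff_forall_galBmaxPlus hp hx).2 ((forall_galBmaxPlus_iff hp _).2 ⟨z, hz, rfl⟩)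

/-- The same with the witness normalised to the given exponent: if `y·pⁿ = x ∈ A_max` and `y` is `Γ_F`-invariant then
`x = ι z` with `z ∈ W(k̄)^{Γ_F}`. [cite: Colmez1998Annals, §III.2] -/
theorem exists_eq_wittToAinf_of_forall_galBmax (hp : valuation F p < 1) {y : D2Cris.Bmax F p} {n : ℕ} {x : BmaxPlus F p}
    (hx : y * (p : D2Cris.Bmax F p) ^ n = algebraMap (BmaxPlus F p) (D2Cris.Bmax F p) x)
    (hy : ∀ σ : absoluteGaloisGroup F, D2Cris.galBmax σ y = y) :
    ∃ z : WittVector p (ResidueField (maxUnramifiedCompletion F)),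
      (∀ σ : absoluteGaloisGroup F, WittVector.map (residueGal σ) z = z) ∧ x = ainfToBmaxPlus F p (wittToAinf F p z) :=
  exists_eq_wittToAinf_of_forall_galBmaxPlus hp ((forall_galBmax_iff_forall_galBmaxPlus hp hx).1 hy)

end Main

end SpecC

end Summit.Langlands.Langlands.Theorems

end
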